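import Literature.Analysis.FluidPDE.Wei2016SwirlCriterionProofs
import HarnessLib

/-!
# Wei 2016, proof of Cor. 1.1: the choice of `r₀` with a margin

Analysis/FluidPDE proof file (theorems only; no definitions, no named facts) on the way to
`Literature.Analysis.FluidPDE.Wei2016_logModulus_regularity`
(`LeiZhang2017AxisymmetricCriteria.lean`), after D. Wei, J. Math. Anal. Appl. 435 (2016) =
arXiv:1508.03318, proof of Cor. 1.1: "First, we can take `r₀ ∈ (0, δ₀)` such that
`r₀^{-1/2} M₁ ≥ M₀^{1/4}`, `C₀M₁r₀^{-1/2} + 1 < e^{-1}r₀^{-1}`, … using the property of this `r₀` we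
have `(1 + ln(C₀ max{M₀^{1/4}, r₀^{-1/2}M₁} + 1))^{-3/2} > |ln r₀|^{-3/2}`."

The printed choice makes the hypothesis `|Γ| ≤ |ln r|^{-3/2}` (`r ≤ r₀`) imply condition (a) of
Thm. 1.1 with the *exact* constants of Lemma 2.3, under which the dissipation of the energy
method is entirely consumed (§3, (3.6)). The tree's rendering keeps a fraction `1 − θ` of the
dissipation by running Lemma 2.3 with the Hardy constant `θ ε^{-1/3}` (`θ = 9/16`), i.e. with
Wei's `K` at the parameter `ε' = θ^{-3/4} ε`; this costs the factor `θ^{-3/4}` in the threshold,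
which the margin `r₀^{-1/2}` versus `r₀^{-1}` of the printed choice absorbs: it suffices to take
`r₀` with `C₀M₁r₀^{-1/2} + 1 < e^{-1} r₀^{-3/4}` (`3/4 = θ^{1/2}`). This file records that choice:

* `Wei2016.rpow_mul_abs_log_lt_threshold` — if `X + 1 < e^{-1} r₀^{-c}` (`0 < r₀ < 1`, `c > 0`,
  `X ≥ 0`) then `(c|ln r₀|)^{-3/2} < (1 + ln(X + 1))^{-3/2}`;
* `Wei2016.exists_r₀_theta` — for `δ₀ > 0`, `M₀ ≥ 0`, `M₁ > 0`, `C₀ ≥ 0` there is `r₀ ∈ (0, δ₀)`,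
  `r₀ < 1`, with `M₀^{1/4} ≤ r₀^{-1/2}M₁` and `C₀M₁r₀^{-1/2} + 1 < e^{-1} r₀^{-3/4}` (`r₀ = s⁴`);
* `Wei2016.exists_r₀_threshold_theta` — hence `((3/4)|ln r|)^{-3/2} < (1 + ln(C₀r₀^{-1/2}M₁ + 1))^{-3/2}`
  for all `0 < r ≤ r₀`, and `max{M₀^{1/4}, r₀^{-1/2}M₁} = r₀^{-1/2}M₁`.

## References

* D. Wei, arXiv:1508.03318, proof of Cor. 1.1 (choice of `r₀`). [Wei2016]
-/

noncomputable section

open Set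

namespace Literature.Analysis.FluidPDE

namespace Wei2016

/-- **Threshold comparison with a margin**: if `0 < r₀ < 1`, `X ≥ 0` and
`X + 1 < e^{-1} r₀^{-c}`, then `1 + ln(X + 1) < c|ln r₀|`, hence
`(c |ln r₀|)^{-3/2} < (1 + ln(X + 1))^{-3/2}`. [cite: Wei2016, proof of Cor. 1.1 (last display)] -/
theorem rpow_mul_abs_log_lt_threshold {X r₀ c : ℝ} (hX : 0 ≤ X) (hr₀ : 0 < r₀) (hr₀1 : r₀ < 1)
    (h : X + 1 < Real.exp (-1) * r₀ ^ (-c)) :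
    (c * |Real.log r₀|) ^ (-(3 / 2 : ℝ)) < (1 + Real.log (X + 1)) ^ (-(3 / 2 : ℝ)) := by
  have hlog₀ : Real.log r₀ < 0 := Real.log_neg hr₀ hr₀1
  have h1 : 0 < 1 + Real.log (X + 1) := by
    have : 0 ≤ Real.log (X + 1) := Real.log_nonneg (by linarith)
    linarith
  have h2 : 1 + Real.log (X + 1) < c * |Real.log r₀| := by
    have hpos : 0 < Real.exp (-1) * r₀ ^ (-c) := mul_pos (Real.exp_pos _) (Real.rpow_pos_of_pos hr₀ _)
    have hlt : Real.log (X + 1) < Real.log (Real.exp (-1) * r₀ ^ (-c)) :=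
      Real.log_lt_log (by linarith) h
    rw [Real.log_mul (Real.exp_pos _).ne' (Real.rpow_pos_of_pos hr₀ _).ne', Real.log_exp,
      Real.log_rpow hr₀] at hlt
    rw [abs_of_neg hlog₀]
    nlinarith
  exact Real.rpow_lt_rpow_of_neg h1 h2 (by norm_num)

/-- **The radius `r₀` with a margin**: for `δ₀ > 0`, `M₀ ≥ 0`, `M₁ > 0`, `C₀ ≥ 0` there is
`r₀ ∈ (0, δ₀)`, `r₀ < 1`, with `M₀^{1/4} ≤ r₀^{-1/2} M₁` and `C₀M₁ r₀^{-1/2} + 1 < e^{-1} r₀^{-3/4}`.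
Explicitly `r₀ = s⁴` with
`s = min (min (1/2) (min δ₀ 1)) (min (M₁/(M₀^{1/4} + 1)) (e^{-1}/(2(C₀M₁ + 1))))`
(`r₀^{-1/2} = s^{-2}`, `r₀^{-3/4} = s^{-3}`; the second condition is `C₀M₁ s + s³ < e^{-1}`).
[cite: Wei2016, proof of Cor. 1.1 (first display)] -/
theorem exists_r₀_theta {δ₀ M₀ M₁ C₀ : ℝ} (hδ₀ : 0 < δ₀) (hM₀ : 0 ≤ M₀) (hM₁ : 0 < M₁) (hC₀ : 0 ≤ C₀) :
    ∃ r₀ : ℝ, 0 < r₀ ∧ r₀ < δ₀ ∧ r₀ < 1 ∧ M₀ ^ (1 / 4 : ℝ) ≤ r₀ ^ (-(1 / 2 : ℝ)) * M₁ ∧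
      C₀ * M₁ * r₀ ^ (-(1 / 2 : ℝ)) + 1 < Real.exp (-1) * r₀ ^ (-(3 / 4 : ℝ)) := by
  have hm : 0 ≤ M₀ ^ (1 / 4 : ℝ) := Real.rpow_nonneg hM₀ _
  have hcm : 0 < C₀ * M₁ + 1 := by positivity
  set s : ℝ := min (min (1 / 2) (min δ₀ 1)) (min (M₁ / (M₀ ^ (1 / 4 : ℝ) + 1))
    (Real.exp (-1) / (2 * (C₀ * M₁ + 1)))) with hs
  have hspos : 0 < s :=
    lt_min (lt_min (by norm_num) (lt_min hδ₀ one_pos)) (lt_min (by positivity) (by positivity))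
  have hs12 : s ≤ 1 / 2 := (min_le_left _ _).trans (min_le_left _ _)
  have hsδ : s ≤ δ₀ := (min_le_left _ _).trans ((min_le_right _ _).trans (min_le_left _ _))
  have hs1 : s ≤ 1 := hs12.trans (by norm_num)
  have hsM : s ≤ M₁ / (M₀ ^ (1 / 4 : ℝ) + 1) := (min_le_right _ _).trans (min_le_left _ _)
  have hsC : s ≤ Real.exp (-1) / (2 * (C₀ * M₁ + 1)) := (min_le_right _ _).trans (min_le_right _ _)
  -- the powers of `r₀ = s⁴`
  have hr4 : (0 : ℝ) < s ^ 4 := by positivity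
  have hpow : ∀ q : ℝ, (s ^ 4) ^ q = s ^ (4 * q) := fun q => by
    rw [← Real.rpow_natCast s 4, ← Real.rpow_mul hspos.le]
    norm_num
  have hr12 : (s ^ 4) ^ (-(1 / 2 : ℝ)) = (s ^ 2)⁻¹ := by
    rw [hpow, show (4 : ℝ) * -(1 / 2) = -(2 : ℕ) by norm_num, Real.rpow_neg hspos.le,
      Real.rpow_natCast]
  have hr34 : (s ^ 4) ^ (-(3 / 4 : ℝ)) = (s ^ 3)⁻¹ := by
    rw [hpow, show (4 : ℝ) * -(3 / 4) = -(3 : ℕ) by norm_num, Real.rpow_neg hspos.le,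
      Real.rpow_natCast]
  refine ⟨s ^ 4, hr4, ?_, ?_, ?_, ?_⟩
  · -- `s⁴ = s · s³ ≤ s/8 < s ≤ δ₀`
    have h3 : s ^ 3 ≤ (1 / 2) ^ 3 := pow_le_pow_left₀ hspos.le hs12 3
    have h4 : s ^ 4 ≤ s * (1 / 2) ^ 3 := by nlinarith
    nlinarith
  · -- `s⁴ < 1`
    exact pow_lt_one₀ hspos.le (by linarith) (by norm_num)
  · -- `s² (M₀^{1/4}) ≤ s (M₀^{1/4} + 1) ≤ M₁`
    rw [hr12, le_inv_mul_iff₀ (by positivity)]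
    have h1 : s * (M₀ ^ (1 / 4 : ℝ) + 1) ≤ M₁ := by rwa [le_div_iff₀ (by positivity)] at hsM
    nlinarith [mul_nonneg hspos.le hm]
  · -- `C₀M₁ s + s³ < e^{-1}`
    rw [hr12, hr34]
    have h1 : s * (C₀ * M₁ + 1) ≤ Real.exp (-1) / 2 := by
      rw [le_div_iff₀ (by positivity)] at hsC
      linarith
    have hexp : 0 < Real.exp (-1) := Real.exp_pos _
    have hs3 : s ^ 3 ≤ s := by nlinarith [pow_le_one₀ hspos.le hs1 (n := 2)]
    have hkey : C₀ * M₁ * s + s ^ 3 < Real.exp (-1) := by nlinarith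
    rw [← sub_pos]
    have : Real.exp (-1) * (s ^ 3)⁻¹ - (C₀ * M₁ * (s ^ 2)⁻¹ + 1) =
        (Real.exp (-1) - (C₀ * M₁ * s + s ^ 3)) / s ^ 3 := by
      field_simp
    rw [this]
    exact div_pos (sub_pos.2 hkey) (pow_pos hspos 3)

/-- **The threshold step of Cor. 1.1 with the margin `θ = 9/16` (`θ^{1/2} = 3/4`)**: for
`δ₀ ∈ (0, 1)`, `M₀ ≥ 0`, `M₁ > 0`, `C₀ ≥ 0` there is `r₀ ∈ (0, δ₀)` with
`max{M₀^{1/4}, r₀^{-1/2}M₁} = r₀^{-1/2}M₁` and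
`((3/4)|ln r|)^{-3/2} < (1 + ln(C₀ r₀^{-1/2} M₁ + 1))^{-3/2}` for all `0 < r ≤ r₀`
(`((3/4)|ln r|)^{-3/2} = θ^{-3/4}|ln r|^{-3/2}` is the parameter `ε'` at which Wei's `K` is run).
[cite: Wei2016, proof of Cor. 1.1] -/
theorem exists_r₀_threshold_theta {δ₀ M₀ M₁ C₀ : ℝ} (hδ₀ : 0 < δ₀) (hM₀ : 0 ≤ M₀)
    (hM₁ : 0 < M₁) (hC₀ : 0 ≤ C₀) :
    ∃ r₀ : ℝ, 0 < r₀ ∧ r₀ < δ₀ ∧ r₀ < 1 ∧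
      max (M₀ ^ (1 / 4 : ℝ)) (r₀ ^ (-(1 / 2 : ℝ)) * M₁) = r₀ ^ (-(1 / 2 : ℝ)) * M₁ ∧
      ∀ r : ℝ, 0 < r → r ≤ r₀ →
        ((3 / 4 : ℝ) * |Real.log r|) ^ (-(3 / 2 : ℝ)) <
          (1 + Real.log (C₀ * (r₀ ^ (-(1 / 2 : ℝ)) * M₁) + 1)) ^ (-(3 / 2 : ℝ)) := by
  obtain ⟨r₀, hr₀, hr₀δ, hr₀1, h1, h2⟩ := exists_r₀_theta hδ₀ hM₀ hM₁ hC₀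
  refine ⟨r₀, hr₀, hr₀δ, hr₀1, max_eq_right h1, fun r hr hrr₀ => ?_⟩
  have hX : 0 ≤ C₀ * (r₀ ^ (-(1 / 2 : ℝ)) * M₁) :=
    mul_nonneg hC₀ (mul_nonneg (Real.rpow_nonneg hr₀.le _) hM₁.le)
  have h2' : C₀ * (r₀ ^ (-(1 / 2 : ℝ)) * M₁) + 1 < Real.exp (-1) * r₀ ^ (-(3 / 4 : ℝ)) := by
    have : C₀ * (r₀ ^ (-(1 / 2 : ℝ)) * M₁) = C₀ * M₁ * r₀ ^ (-(1 / 2 : ℝ)) := by ring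
    rw [this]
    exact h2
  have hmain := rpow_mul_abs_log_lt_threshold hX hr₀ hr₀1 h2'
  -- monotonicity in `r`: `(3/4)|ln r| ≥ (3/4)|ln r₀|`
  have hlog₀ : Real.log r₀ < 0 := Real.log_neg hr₀ hr₀1
  have hlog : Real.log r ≤ Real.log r₀ := Real.log_le_log hr hrr₀
  have habs : |Real.log r₀| ≤ |Real.log r| := by
    rw [abs_of_neg hlog₀, abs_of_neg (hlog.trans_lt hlog₀)]
    linarith
  have hmono : ((3 / 4 : ℝ) * |Real.log r|) ^ (-(3 / 2 : ℝ)) ≤ ((3 / 4 : ℝ) * |Real.log r₀|) ^ (-(3 / 2 : ℝ)) :=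
    Real.rpow_le_rpow_of_nonpos (mul_pos (by norm_num) (abs_pos.2 hlog₀.ne) : (0 : ℝ) < 3 / 4 * |Real.log r₀|)
      (by nlinarith) (by norm_num)
  exact hmono.trans_lt hmain

end Wei2016

end Literature.Analysis.FluidPDE

end
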